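import Summits.BirchSwinnertonDyer.Rank1Residual.X11b.BDPRouteOpenInputOdd
import Literature.NumberTheory.EllipticCurves.SkinnerUrban2014.SemistableCurvesProofs
import Literature.NumberTheory.EllipticCurves.SemistablePeuRamifieRamifiedPrime
import HarnessLib

/-!
# X11b at `p ∈ {3, 5, 7}` on SEMISTABLE curves: route p2's typed inputs reduce to THE open input
# and the Euler-system half on `p ∣ ∏ c_ℓ` (cell `b2b-bsdres`, seat rmap-3 gen 4; RESIDUAL-MAP.md §H
# 'X11b@3 on semistable curves' ⟦g4⟧, §S.2 X11b@3 kernel row)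

HONEST FRAMING (run/shared/lean/b2b/bsd-rank1-residual/, verbatim in every file): the goal of the
cell is to DELETE the COMBINATION-SHAPED residual classes of the Birch–Swinnerton-Dyer formula for
ALL analytic-rank `≤ 1` elliptic curves over `ℚ` — "full BSD formula for every rank `≤ 1` curve in
class `C`" assembled STRICTLY from published theorems — so that the rank-`≤ 1` remainder becomes
exactly the CONSTRUCTION-SHAPED classes, which are TYPED (missing-input `Prop`s), NOT attempted.
This is not "finishing BSD". Nothing here is a Literature statement; NO named fact is introduced;
X11b stays CONSTRUCTION-SHAPED (its open input has no source at `p = 3`, an unrefereed one at `p ≥ 5`).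

multr1-p2's record of route p2 at an odd prime (`X11b.bsdp_of_classX11b_odd_of_onTreeInputs`,
named form `X11b.P2.bsdp_of_onTree_algebraic_odd`; `p = 3` row `X11b.P2.bsdp_three_of_onTree`) reads:
`(E, p) ∈` X11b `→ BSD(E, p)` from twelve published named facts and THREE typed inputs —
(T1ᵗ-IMC) THE open input `X11b.P2OpenInputOnTreeOddAt W p` at the surjective pairs, (T2′) the
Euler-system half `Typed.MissingUpperBoundAt` off the unconditional atom `(ram) ∧ p ∤ ∏ c_ℓ`, and
(T4″) `Typed.MissingPPartAt` on the non-surjective corner.  On a SEMISTABLE curve with `E[p]`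
irreducible, `ρ̄_{E,p}` is onto (`surj_of_irr_of_semistable`, Serre) and, for
`p ≤ 7`, (ram) is AUTOMATIC (`ram_of_semistable_of_irr_of_le_seven`, rmap-3 gen 4: Ribet to level
one, Serre's weight `≤ p + 1 ≤ 8 < 12`), so (T4″) is vacuous and (T2′) is needed only on
`p ∣ ∏ c_ℓ`: **for a semistable `(E, p) ∈` X11b with `p ∈ {3, 5, 7}`, `BSD(E, p)` follows from the
twelve published facts + THE open input at this pair + the Euler-system half in case `p ∣ ∏ c_ℓ`**
(`bsdp_of_semistable_classX11b_of_openInput_of_le_seven`; `p = 3`: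
`bsdp_three_of_semistable_classX11b_of_openInput`), and on the atom `p ∤ ∏ c_ℓ` from the open input
ALONE (`bsdp_of_semistable_classX11b_of_openInput_of_not_dvd_of_le_seven`).  In census3's language
(multr1-p2 gen 18, `3 ‖ N`, `r = 1`, `E[3]` irreducible, N < 5·10⁵: 383 149 classes, corner ¬Surj 296,
¬Ram 10 467) every corner / ¬Ram class is NON-semistable; on semistable classes only atoms
A1 = (ram) ∧ 3 ∤ ∏c (open input only) and A2 = (ram) ∧ 3 ∣ ∏c (open input + (T2′)) occur.
CONDITIONAL on the named facts and the typed inputs; nothing booked; labels UNCHANGED.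

References: `X11b/BDPRouteOddOnTree.lean`, `X11b/BDPRouteOpenInputOdd.lean` (multr1-p2 gen 18);
`Literature/…/SemistablePeuRamifieRamifiedPrime.lean`; RESIDUAL-MAP.md §H / §S.2.
-/

namespace Summit.BirchSwinnertonDyer.Rank1Residual

open WeierstrassCurve NumberField IsDedekindDomain
open Literature.NumberTheory.EllipticCurves Literature.NumberTheory.EllipticCurves.Rank1Residual
  Literature.NumberTheory.EllipticCurves.Rank1Residual.Typed
  Literature.NumberTheory.EllipticCurves.ModularForms Literature.NumberTheory.EllipticCurves.Wuthrich2014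
  Literature.NumberTheory.GaloisRepresentations Literature.NumberTheory.GaloisCohomology
open scoped NumberField

section Curve

variable (W : WeierstrassCurve ℚ) [W.IsElliptic] [W.IsGloballyMinimal] (p : ℕ) [Fact p.Prime]

/-- **X11b at `p ∈ {3, 5, 7}` on a SEMISTABLE curve: BSD(E, p) from the twelve published facts +
THE open input at this pair + the Euler-system half (T2′) in case `p ∣ ∏ c_ℓ`** — the corner input
(T4″) of `X11b.bsdp_of_classX11b_odd_of_onTreeInputs` is vacuous (`ρ̄_{E,p}` onto: Serre) and (ram)
is automatic (`ram_of_semistable_of_irr_of_le_seven`), so (T2′) off the atom `(ram) ∧ p ∤ ∏c` is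
(T2′) on `p ∣ ∏c`.  CONDITIONAL; nothing booked. [folklore] -/
theorem bsdp_of_semistable_classX11b_of_openInput_of_le_seven
    -- published inputs (named facts of the tree)
    (hGZ : ∀ (N : ℕ) [NeZero N] (W : WeierstrassCurve ℚ) (K : Type) [Field K] [NumberField K],
      gross_zagier N W K)
    (hKo : ∀ (N : ℕ) [NeZero N] (W : WeierstrassCurve ℚ) (K : Type) [Field K] [NumberField K],
      kolyvagin N W K)
    (hB : ∀ (N : ℕ) [NeZero N] (W : WeierstrassCurve ℚ) (K : Type) [Field K] [NumberField K],
      Kolyvagin1990_padicValNat_card_sha_le N W K)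
    (hSk : Skinner2016.thmC_padicValRat_bsd_rank_zero) (hWu : sha_dvd_analyticSha)
    (hGZK : rank_eq_analyticRank_of_analyticRank_le_one) (hmod : hasEntireLFunction_rat)
    (hnf : exists_isNewformOf) (hHL : HoffsteinLuo1997_exists_twist_L_one_ne_zero)
    (hMaz : mazur_not_dvd_maninConstant_of_odd)
    (hPT : ∀ (K : Type) [Field K] [NumberField K], poitouTate_sum_localTatePairing_eq_zero K)
    (hEP : ∀ (K : Type) [Field K] [NumberField K] (v : HeightOneSpectrum (𝓞 K)),
      localEulerPoincareCharacteristic (v.adicCompletion K))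
    (hLL : Literature.NumberTheory.Automorphic.diamond1995_refinedSerre)
    -- the pair: semistable, X11b, `p ≤ 7`
    (hsst : Semistable W) (hp7 : p ≤ 7) (hX : ClassX11b W p)
    -- (T1ᵗ-IMC, odd) THE open input at this pair
    (hA : X11b.P2OpenInputOnTreeOddAt W p)
    -- (T2′) the Euler-system half, demanded only when `p ∣ ∏ c_ℓ`
    (hU : p ∣ W.tamagawaProduct → Typed.MissingUpperBoundAt W p) : BSDp W p := by
  have hX' := hX
  obtain ⟨hr, hp2, -, hirr⟩ := hX
  have hsurj : Surj W p := surj_of_irr_of_semistable W p hirr hsst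
  have hram : Ram W p := ram_of_semistable_of_irr_of_le_seven hnf hLL W p hp2 hp7 hsst hirr
  refine Typed.bsdp_of_missingPPartAt W p hGZK (by rw [hr]) ?_
  refine Typed.missingPPartAt_of_lower_of_upper W p
    (X11b.P2.missingLowerBoundAt_of_openInputOddAt W p hGZ hKo hWu hGZK hmod hnf hHL hMaz hPT hEP hA
      hX' hsurj) ?_
  by_cases htam : p ∣ W.tamagawaProduct
  · exact hU htam
  · exact X11b.missingUpperBoundAt_of_classX11b_of_ram_of_not_dvd hGZ hKo hB hSk hGZK hmod hnf hHL
      hMaz integral_neronScaling_of_isGloballyMinimal_holds W p hX' hram htam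

/-- **On the atom `p ∤ ∏ c_ℓ` (census3's A1 at `p = 3`) a semistable X11b pair with `p ∈ {3,5,7}`
needs THE open input ONLY** — both halves' other inputs are theorems there ((ram) automatic, `ρ̄`
onto, Euler-system half = `X11b.missingUpperBoundAt_of_classX11b_of_ram_of_not_dvd`).
CONDITIONAL on the open input; nothing booked. [folklore] -/
theorem bsdp_of_semistable_classX11b_of_openInput_of_not_dvd_of_le_seven
    (hGZ : ∀ (N : ℕ) [NeZero N] (W : WeierstrassCurve ℚ) (K : Type) [Field K] [NumberField K],
      gross_zagier N W K)
    (hKo : ∀ (N : ℕ) [NeZero N] (W : WeierstrassCurve ℚ) (K : Type) [Field K] [NumberField K],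
      kolyvagin N W K)
    (hB : ∀ (N : ℕ) [NeZero N] (W : WeierstrassCurve ℚ) (K : Type) [Field K] [NumberField K],
      Kolyvagin1990_padicValNat_card_sha_le N W K)
    (hSk : Skinner2016.thmC_padicValRat_bsd_rank_zero) (hWu : sha_dvd_analyticSha)
    (hGZK : rank_eq_analyticRank_of_analyticRank_le_one) (hmod : hasEntireLFunction_rat)
    (hnf : exists_isNewformOf) (hHL : HoffsteinLuo1997_exists_twist_L_one_ne_zero)
    (hMaz : mazur_not_dvd_maninConstant_of_odd)
    (hPT : ∀ (K : Type) [Field K] [NumberField K], poitouTate_sum_localTatePairing_eq_zero K)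
    (hEP : ∀ (K : Type) [Field K] [NumberField K] (v : HeightOneSpectrum (𝓞 K)),
      localEulerPoincareCharacteristic (v.adicCompletion K))
    (hLL : Literature.NumberTheory.Automorphic.diamond1995_refinedSerre)
    (hsst : Semistable W) (hp7 : p ≤ 7) (hX : ClassX11b W p) (htam : ¬ p ∣ W.tamagawaProduct)
    (hA : X11b.P2OpenInputOnTreeOddAt W p) : BSDp W p :=
  bsdp_of_semistable_classX11b_of_openInput_of_le_seven W p hGZ hKo hB hSk hWu hGZK hmod hnf hHL hMaz
    hPT hEP hLL hsst hp7 hX hA (fun h ↦ absurd h htam)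

/-- **The `p = 3` row (RESIDUAL-MAP §H / §S.2 X11b@3): a semistable curve in X11b@3 satisfies
`BSD(E, 3)` from the twelve published facts + THE open input at `3` (no source, not even announced)
+ the Euler-system half in case `3 ∣ ∏ c_ℓ`.**  CONDITIONAL; nothing booked; X11 ∧ `r = 1` at `3`
stays CONSTRUCTION-SHAPED. [folklore] -/
theorem bsdp_three_of_semistable_classX11b_of_openInput [Fact (Nat.Prime 3)]
    (hGZ : ∀ (N : ℕ) [NeZero N] (W : WeierstrassCurve ℚ) (K : Type) [Field K] [NumberField K],
      gross_zagier N W K)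
    (hKo : ∀ (N : ℕ) [NeZero N] (W : WeierstrassCurve ℚ) (K : Type) [Field K] [NumberField K],
      kolyvagin N W K)
    (hB : ∀ (N : ℕ) [NeZero N] (W : WeierstrassCurve ℚ) (K : Type) [Field K] [NumberField K],
      Kolyvagin1990_padicValNat_card_sha_le N W K)
    (hSk : Skinner2016.thmC_padicValRat_bsd_rank_zero) (hWu : sha_dvd_analyticSha)
    (hGZK : rank_eq_analyticRank_of_analyticRank_le_one) (hmod : hasEntireLFunction_rat)
    (hnf : exists_isNewformOf) (hHL : HoffsteinLuo1997_exists_twist_L_one_ne_zero)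
    (hMaz : mazur_not_dvd_maninConstant_of_odd)
    (hPT : ∀ (K : Type) [Field K] [NumberField K], poitouTate_sum_localTatePairing_eq_zero K)
    (hEP : ∀ (K : Type) [Field K] [NumberField K] (v : HeightOneSpectrum (𝓞 K)),
      localEulerPoincareCharacteristic (v.adicCompletion K))
    (hLL : Literature.NumberTheory.Automorphic.diamond1995_refinedSerre)
    (hsst : Semistable W) (hX : ClassX11b W 3) (hA : X11b.P2OpenInputOnTreeOddAt W 3)
    (hU : 3 ∣ W.tamagawaProduct → Typed.MissingUpperBoundAt W 3) : BSDp W 3 :=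
  bsdp_of_semistable_classX11b_of_openInput_of_le_seven W 3 hGZ hKo hB hSk hWu hGZK hmod hnf hHL hMaz
    hPT hEP hLL hsst (by norm_num) hX hA hU

end Curve

end Summit.BirchSwinnertonDyer.Rank1Residual
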